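import Literature.AnabelianGeometry.EtaleTheta.Discharge.Sec5CyclotomicRigidityCodOfBiKummerData
import Literature.AnabelianGeometry.EtaleTheta.Discharge.Sec5Prop55GaloisLeafOfBiKummerData

/-!
# [EtTh] Prop. 5.5, varying codomains, at the GENUINE §5 data — the co-filtration (a) and Galois (b) leaves reduced
# (PDF pp. 101–102 = printed 327–328; Prop. 4.2 (iv) p.315 (PDF p.89))

Mochizuki, *The étale theta function and its Frobenioid-theoretic manifestations*, Publ. RIMS **45** (2009)
[cite: MochizukiEtTh2009, Prop 5.5 p.327–328 (PDF pp.101–102)].  abc-iut cell, layer L2, sequel of row #1-R7 (seat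
abc-iut-w5-d020 gen 3; abc-iut-L2-lead #5-R43: «(Fc)/hcof/hgalCod/IsAutAmple-at-codomains belong to the tower constructor»).
PROOF-ONLY (no definitions, no new named fact).

`cyclotomicRigidityCod_ofBiKummerData_roots` (p424534) assembles Prop. 5.5 in the varying-codomain currency for abc-iut-L2-t4's
§5 data `ofBiKummerData …`, sources = the codomains `(Rι i).BN` of a family of `N`-th root data of the same fraction-pair,
modulo `{ν, hcodSat, hreach, (Fc) hfun, (a) hcof, (b) hgalCod, hLc/hLi}`.  Here two of these leaves are REDUCED to their
print-level inputs:
* (a) `hcof` — «linear morphisms `S″ → S`, `S″ → S‴` … which induce isomorphisms» (p.328 l.2–8) between two ROOT codomains is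
  supplied by **Prop. 4.2 (iv)** (p.315 (PDF p.89): «an isomorphism between the two given `N`-th roots … `ζ_B : B_N ⥲ B̄_N`»):
  the abstract lemma `Thm56Sub.cofiltered_of_nonempty_iso` dominates `(S₁, S₂)` by `(S₁, 𝟙, ζ)`; along an isomorphism `Δ-push`
  and `μ-pull` are bijective by the transport laws P55-L06b (`UnitsPullComp/Id` — theorems at the model; `LDeltaMapComp/Id` —
  laws of the free stub `Q`);
* (b) `hgalCod` — at every root codomain it is abc-iut-w4-d099's leaf (G) (`baseTorsor_ofBiKummerData_of_galoisHomTorsor`,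
  p425506, at THAT root; one base functor, rfl) from the base-category law `hGalT` «a Galois object is an `Aut`-torsor over every
  target» ([SemiAnbd] Rmk. 3.1.3; PROVED for `B^temp(Π)⁰`, p424508; GAP-LEDGER G-w4d099-1);
giving `cyclotomicRigidityCod_ofBiKummerData_roots_of_laws` modulo exactly: `ν` (native isos; Prop. 5.2 (iii)/1.3 at each root),
`hcodSat` (Def. 5.4), `hreach` (abc-iut-w5-d123's `ReachableFromCodomains`; [FrdI] Def. 1.3 (i)(b)), (Fc) `hfun` («manifestly
"functorial"», p.328 l.1–2), `hiso` (Prop. 4.2 (iv)), `hGalT`, `hLc`/`hLi`.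
HONEST FRAMING: kernel-checked implications between typed statements about the assembled §5 data; nothing of [EtTh] is asserted
unconditionally; nothing asserts that such data exist for an actual curve; typed ≠ discharged; no side taken on [IUTchIII] Cor. 3.12.
-/

noncomputable section

namespace Literature.AnabelianGeometry.EtaleTheta

open CategoryTheory Opposite FrobenioidCyclotomicRigidity Literature.AlgebraicGeometry.Frobenioids

universe u₀ v₀ u v w w₁ v₁ v₁' u₁ u₁'

namespace ThetaFrobenioid

/-! ### Abstract §5 data: transport along isomorphisms; co-filtration from pairwise isomorphic codomains -/

namespace Thm56Sub

variable {C : Type u₁} [Category.{v₁} C] {D : Type u₁'} [Category.{v₁'} D] {𝔉 : ThetaFrobenioid.{w₁} C D}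

/-- Along an isomorphism `ζ : S₁ ⥲ S₂` the push-forward `(l·Δ_Θ)_{S₁} ⊗ ℤ/Nℤ → (l·Δ_Θ)_{S₂} ⊗ ℤ/Nℤ` is onto (laws
`LDeltaMapComp/Id`; «induce isomorphisms», p.328 l.5–6).  [cite: MochizukiEtTh2009, Prop 5.5 proof p.328 (PDF p.102)] -/
theorem lDeltaModNMap_iso_surjective (hLc : LDeltaMapComp 𝔉) (hLi : LDeltaMapId 𝔉) {S₁ S₂ : C} (ζ : S₁ ≅ S₂) :
    Function.Surjective (𝔉.lDeltaModNMap ζ.hom) := fun y =>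
  ⟨𝔉.lDeltaModNMap ζ.inv y, by rw [← lDeltaModNMap_comp hLc, Iso.inv_hom_id, lDeltaModNMap_id hLi]⟩

/-- Along an isomorphism `ζ : S₁ ⥲ S₂` the pull-back of cyclotomes `μ_N(S₂) → μ_N(S₁)` is injective (laws `UnitsPullComp/Id`;
«`μ_N(S) ⥲ μ_N(S″)`», p.328 l.7–8).  [cite: MochizukiEtTh2009, Prop 5.5 proof p.328 (PDF p.102)] -/
theorem muTorsionPull_iso_injective (hUc : UnitsPullComp 𝔉) (hUi : UnitsPullId 𝔉) {S₁ S₂ : C} (ζ : S₁ ≅ S₂) :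
    Function.Injective (𝔉.muTorsionPull ζ.hom 𝔉.N) := fun u u' h => by
  have key := congrArg (𝔉.muTorsionPull ζ.inv 𝔉.N) h
  rwa [← muTorsionPull_comp hUc, ← muTorsionPull_comp hUc, Iso.inv_hom_id, muTorsionPull_id hUi,
    muTorsionPull_id hUi] at key

/-- **The co-filtration leaf (a) from pairwise ISOMORPHIC codomains** (Prop. 4.2 (iv), p.315 (PDF p.89): «an isomorphism
between the two given `N`-th roots … `ζ_B`»; used at p.328 l.2–8): if any two admissible codomains are isomorphic in `C`, then
two codomains `S₁, S₂` are dominated by `S₁` itself through `𝟙` and `ζ : S₁ ⥲ S₂` — both linear, `Δ-push` onto, `μ-pull(ζ)`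
injective — which is the hypothesis `hcof` of abc-iut-w4-d008's `commonRefinement_of` / `cyclotomicRigidityCod_of_galois`.
[cite: MochizukiEtTh2009, Prop 5.5 proof p.328 (PDF p.102)] -/
theorem cofiltered_of_nonempty_iso {IsCod : C → Prop} (hUc : UnitsPullComp 𝔉) (hUi : UnitsPullId 𝔉)
    (hLc : LDeltaMapComp 𝔉) (hLi : LDeltaMapId 𝔉)
    (hiso : ∀ (S₁ S₂ : C), IsCod S₁ → IsCod S₂ → Nonempty (S₁ ≅ S₂))
    (S₁ S₂ : C) (h₁ : IsCod S₁) (h₂ : IsCod S₂) :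
    ∃ (S₀ : C) (_ : IsCod S₀) (ψ₁ : S₀ ⟶ S₁) (ψ₂ : S₀ ⟶ S₂), 𝔉.IsLinear ψ₁ ∧ 𝔉.IsLinear ψ₂ ∧
      Function.Surjective (𝔉.lDeltaModNMap ψ₁) ∧ Function.Surjective (𝔉.lDeltaModNMap ψ₂) ∧
      Function.Injective (𝔉.muTorsionPull ψ₂ 𝔉.N) := by
  obtain ⟨ζ⟩ := hiso S₁ S₂ h₁ h₂
  refine ⟨S₁, h₁, 𝟙 S₁, ζ.hom, 𝔉.pre.degFr_id S₁, 𝔉.isLinear_iso_hom ζ, ?_,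
    lDeltaModNMap_iso_surjective hLc hLi ζ, muTorsionPull_iso_injective hUc hUi ζ⟩
  intro y
  exact ⟨y, lDeltaModNMap_id hLi S₁ y⟩

end Thm56Sub

/-! ### At the genuine §5 data: leaves (a) and (b) reduced -/

variable {K : Type u₀} [Field K]
  {X : SemiGraphs.TemperedArithmeticGroup.{u₀} K} {D₀ : Type u₀} [Category.{v₀} D₀]
  {V : FrdIMonoidStub.{w}} {T₀ : RealifiedDivisorMonoids (D₀ := D₀) V} {D : Type u} [Category.{v} D]
  {VD : FrdICatStub.{u, v, w} D} {S : BiKummerSetting X T₀ D VD}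
  {pullFrac : ∀ {A A' : S.C} (_ : A' ⟶ A), S.biratUnits A → S.biratUnits A'}
  {lv N : ℕ+} {l' : ℕ} {RD : RigidData.{max v w} N l'} {θ : S.biratUnits S.Aodot} {Bl : S.C}
  {Pl : S.FractionPair θ Bl} {Rl : S.NthRoot θ Pl lv pullFrac}
  (h : ModelFrobenioid.Hypotheses S.tf.divisorMonoid S.tf.ratFnFunctor)
  (toB : ∀ A : S.C, S.biratUnits A →* S.tf.biratUnitsModel A) (Q : FrobenioidTheta.ThetaSubquotientStub.{w} D)
  (odd_l : Odd (lv : ℕ)) (R : S.NthRoot Rl.root Rl.pair N pullFrac) (ιX : RD.PiX ≃ₜ* X.Pi)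
  (hopen : IsOpen ((S.galoisSurj R.AN.base R.αData.isGalois).ker : Set X.Pi)) (σ : Aut R.AN.base →* Aut R.AN)
  (K' : Type w) [Field K'] (constEmb : K'ˣ →* S.tf.biratUnitsModel R.BN)
  (constEmb_injective : Function.Injective constEmb)
  (hdivc : ∀ g : Aut R.BN.base,
    ModelFrobenioid.div ((σ ((BiKummerSetting.NthRoot.baseIso S R).conjAut.symm g)).hom ≫ R.pair.num) =
      ModelFrobenioid.div R.pair.num)
  (hdivp : ∀ y : RD.PiYdd,
    ModelFrobenioid.div ((σ (S.galoisSurj R.AN.base R.αData.isGalois (ιX y.1))).hom ≫ R.pair.den) =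
      ModelFrobenioid.div R.pair.den)
  {ι : Type*} (Rι : ι → S.NthRoot Rl.root Rl.pair N pullFrac)
  (hopenι : ∀ i, IsOpen ((S.galoisSurj (Rι i).AN.base (Rι i).αData.isGalois).ker : Set X.Pi))
  (σι : ∀ i, Aut (Rι i).AN.base →* Aut (Rι i).AN)
  (constEmbι : ∀ i, K'ˣ →* S.tf.biratUnitsModel (Rι i).BN)
  (constEmbι_injective : ∀ i, Function.Injective (constEmbι i))
  (hdivcι : ∀ (i) (g : Aut (Rι i).BN.base),
    ModelFrobenioid.div ((σι i ((BiKummerSetting.NthRoot.baseIso S (Rι i)).conjAut.symm g)).hom ≫ (Rι i).pair.num) =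
      ModelFrobenioid.div (Rι i).pair.num)
  (hdivpι : ∀ (i) (y : RD.PiYdd),
    ModelFrobenioid.div ((σι i (S.galoisSurj (Rι i).AN.base (Rι i).αData.isGalois (ιX y.1))).hom ≫ (Rι i).pair.den) =
      ModelFrobenioid.div (Rι i).pair.den)

include hopenι constEmbι constEmbι_injective hdivcι hdivpι in
/-- **Leaf (b) `hgalCod` at EVERY root codomain from the base law `hGalT`** ([SemiAnbd] Rmk. 3.1.3: a Galois object is an
`Aut`-torsor over every target of the connected base; abc-iut-w4-d099's `baseTorsor_ofBiKummerData_of_galoisHomTorsor`, p425506,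
applied to the data assembled AT the root `Rι i` — the base functor is the same for every root): for `f, f′ : (Rι i).BN → T`
the base arrows differ by an automorphism of `(Rι i).BN^bs` (no linearity or theta-saturation needed).
[cite: MochizukiEtTh2009, Prop 5.5 proof p.328 (PDF p.102)] -/
theorem galoisCod_rootCodomain_ofBiKummerData
    (hGalT : ∀ ⦃A : D⦄, S.IsGaloisObj A → ∀ ⦃T : D⦄ (b b' : A ⟶ T), ∃ g : Aut A, b' = g.hom ≫ b) :
    ∀ (T : S.C),
      (ofBiKummerData h toB Q odd_l R ιX hopen σ K' constEmb constEmb_injective hdivc hdivp).IsThetaSaturated T →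
      ∀ (S₀ : S.C), (∃ i, (Rι i).BN = S₀) → ∀ (f f' : S₀ ⟶ T),
        (ofBiKummerData h toB Q odd_l R ιX hopen σ K' constEmb constEmb_injective hdivc hdivp).IsLinear f →
        (ofBiKummerData h toB Q odd_l R ιX hopen σ K' constEmb constEmb_injective hdivc hdivp).IsLinear f' →
          ∃ g : Aut ((ofBiKummerData h toB Q odd_l R ιX hopen σ K' constEmb constEmb_injective hdivc hdivp).base.obj S₀),
            (ofBiKummerData h toB Q odd_l R ιX hopen σ K' constEmb constEmb_injective hdivc hdivp).base.map f' =
              g.hom ≫ (ofBiKummerData h toB Q odd_l R ιX hopen σ K' constEmb constEmb_injective hdivc hdivp).base.map f := by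
  rintro T - S₀ ⟨i, rfl⟩ f f' - -
  exact baseTorsor_ofBiKummerData_of_galoisHomTorsor h toB Q odd_l (Rι i) ιX (hopenι i) (σι i) K' (constEmbι i)
    (constEmbι_injective i) (hdivcι i) (hdivpι i) hGalT T f f'

include hopenι constEmbι constEmbι_injective hdivcι hdivpι in
/-- **[EtTh] Proposition 5.5 in the varying-codomain currency for the ASSEMBLED §5 data, leaves (a), (b), (c), (U) reduced** —
`CyclotomicRigidityCod (ofBiKummerData …) hcodSat ν` over print's admissible class (the codomains of the root data `Rι i`), with:
(U) and `UnitsPullComp/Id` at the model; (c) Aut-ampleness of every root codomain (p424534); (a) co-filtration from «root codomains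
are pairwise ISOMORPHIC» (`hiso`, Prop. 4.2 (iv) `ζ_B`); (b) the Galois leaf from the base law `hGalT` ([SemiAnbd] Rmk. 3.1.3, via
abc-iut-w4-d099).  Residual NAMED inputs exactly: `ν` (native isos, Prop. 5.2 (iii)/1.3 at each root), `hcodSat` (Def. 5.4), `hreach`
(abc-iut-w5-d123's `ReachableFromCodomains`; [FrdI] Def. 1.3 (i)(b)), (Fc) `hfun` (p.328 l.1–2), `hiso`, `hGalT`, the section
properties `hσι` ([FrdI] Prop. 5.6) and the laws `hLc`/`hLi` of the free subquotient stub `Q`.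
[cite: MochizukiEtTh2009, Prop 5.5 p.327–328 (PDF pp.101–102)] -/
theorem cyclotomicRigidityCod_ofBiKummerData_roots_of_laws
    (hσι : ∀ (i) (g : Aut (Rι i).AN.base), ModelFrobenioid.baseMap (σι i g).hom = g.hom)
    (hcodSat : ∀ S'', (∃ i, (Rι i).BN = S'') →
      (ofBiKummerData h toB Q odd_l R ιX hopen σ K' constEmb constEmb_injective hdivc hdivp).IsThetaSaturated S'')
    (ν : Thm56Sub.NativeIsoFamily
      (ofBiKummerData h toB Q odd_l R ιX hopen σ K' constEmb constEmb_injective hdivc hdivp) (fun S'' => ∃ i, (Rι i).BN = S''))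
    (hreach : ReachableFromCodomains
      (ofBiKummerData h toB Q odd_l R ιX hopen σ K' constEmb constEmb_injective hdivc hdivp) (fun S'' => ∃ i, (Rι i).BN = S''))
    (hLc : Thm56Sub.LDeltaMapComp
      (ofBiKummerData h toB Q odd_l R ιX hopen σ K' constEmb constEmb_injective hdivc hdivp))
    (hLi : Thm56Sub.LDeltaMapId
      (ofBiKummerData h toB Q odd_l R ιX hopen σ K' constEmb constEmb_injective hdivc hdivp))
    (hfun : ∀ (S₁ S₂ : S.C) (h₁ : ∃ i, (Rι i).BN = S₁) (h₂ : ∃ i, (Rι i).BN = S₂) (ψ : S₁ ⟶ S₂),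
      (ofBiKummerData h toB Q odd_l R ιX hopen σ K' constEmb constEmb_injective hdivc hdivp).IsLinear ψ →
      ∀ x : (ofBiKummerData h toB Q odd_l R ιX hopen σ K' constEmb constEmb_injective hdivc hdivp).lDeltaModN S₁,
        (ofBiKummerData h toB Q odd_l R ιX hopen σ K' constEmb constEmb_injective hdivc hdivp).muTorsionPull ψ
            (ofBiKummerData h toB Q odd_l R ιX hopen σ K' constEmb constEmb_injective hdivc hdivp).N
            (ν S₂ h₂ ((ofBiKummerData h toB Q odd_l R ιX hopen σ K' constEmb constEmb_injective hdivc hdivp).lDeltaModNMap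
              ψ x)) = ν S₁ h₁ x)
    (hiso : ∀ i j : ι, Nonempty ((Rι i).BN ≅ (Rι j).BN))
    (hGalT : ∀ ⦃A : D⦄, S.IsGaloisObj A → ∀ ⦃T : D⦄ (b b' : A ⟶ T), ∃ g : Aut A, b' = g.hom ≫ b) :
    Thm56Sub.CyclotomicRigidityCod
      (ofBiKummerData h toB Q odd_l R ιX hopen σ K' constEmb constEmb_injective hdivc hdivp) hcodSat ν := by
  refine cyclotomicRigidityCod_ofBiKummerData_roots h toB Q odd_l R ιX hopen σ K' constEmb constEmb_injective hdivc hdivp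
    Rι hopenι σι constEmbι constEmbι_injective hdivcι hdivpι hσι hcodSat ν hreach hLc hLi hfun ?_
    (galoisCod_rootCodomain_ofBiKummerData h toB Q odd_l R ιX hopen σ K' constEmb constEmb_injective hdivc hdivp Rι hopenι
      σι constEmbι constEmbι_injective hdivcι hdivpι hGalT)
  -- (a) co-filtration from pairwise isomorphic root codomains
  rintro S₁ S₂ ⟨i, rfl⟩ ⟨j, rfl⟩
  exact Thm56Sub.cofiltered_of_nonempty_iso
    (unitsPullComp_ofBiKummerData h toB Q odd_l R ιX hopen σ K' constEmb constEmb_injective hdivc hdivp)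
    (unitsPullId_ofBiKummerData h toB Q odd_l R ιX hopen σ K' constEmb constEmb_injective hdivc hdivp) hLc hLi
    (fun S₁ S₂ ⟨i, hi⟩ ⟨j, hj⟩ => hi ▸ hj ▸ hiso i j) _ _ ⟨i, rfl⟩ ⟨j, rfl⟩

end ThetaFrobenioid

end Literature.AnabelianGeometry.EtaleTheta

end
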